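import Literature.NumberTheory.GaloisRepresentations.HerbrandFunction
import HarnessLib

/-!
# Herbrand's theorem: the upper numbering passes to quotients (trunk GalRep, item C9)

This file proves the combinatorial half of Herbrand's theorem (Serre, *Local Fields*, Ch. IV §3,
Lemmas 3–5, Prop. 14, Prop. 15) for the lower/upper ramification filtrations of the parent files
`RamificationFiltration.lean` / `HerbrandFunction.lean`, reduces the named fact
`Literature.NumberTheory.GaloisRepresentations.herbrand_quotient` (Prop. 14 for `Gal(L/K) → Gal(E/K)` on integral closures over a Dedekind
domain) to a single arithmetic input — Serre's index formula Ch. IV §1 Prop. 3, the hypothesis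
`IndexFormula` (discharged in `RamificationFiltrationHerbrandQuotientProofs.lean`) — and proves the
other arithmetic input, the surjectivity of inertia groups along `Gal(L/K) → Gal(E/K)` (Serre,
Ch. I §7, Prop. 22 b)).

## Contents

* `Literature.lowerIndex 𝔓 G s : ℕ∞` — Serre's function `i_G` ("the order function of the filtration
  `(G_i)`, increased by one unit"): `s ∈ G_i ↔ i + 1 ≤ i_G(s)`, `i_G(1) = ⊤`,
  `i_G(st) ≥ inf(i_G(s), i_G(t))`, `i_G(t s t⁻¹) = i_G(s)`; for a subgroup `H ≤ G` acting by
  restriction, `H_i = G_i ∩ H` and `i_H = i_G|_H` (Prop. 2) hold by `Iff.rfl`.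
* Lemma 3 at integers: `Σ_{s ∈ G} inf(i_G(s), m + 1) = Σ_{i ≤ m} #G_i = #G_0 (φ(m) + 1)`
  (`finsum_min_lowerIndex`).
* Abstract quotient setting: a homomorphism `π : G →* Q`, `G` acting on `(S, 𝔓)`, `Q` on
  `(S', 𝔮)`, `H = ker π`; hypotheses `(G_0).map π = Q_0`, `G_N = 1` for some `N`, and
  `IndexFormula` (Prop. 3 with `e' = Card(H_0)`).  Under these: Lemma 4
  (`lowerIndex_map_eq_of_max`), **Herbrand's theorem** `π(G_u) = Q_{φ_H(u)}`
  (`map_ramificationSubgroup_eq_of_indexFormula`, Lemma 5), transitivity `φ_G = φ_Q ∘ φ_H`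
  (`herbrandPhi_eq_herbrandPhi_comp_of_indexFormula`, Prop. 15) and `Q^v = π(G^v)`
  (`upperRamificationSubgroup_eq_map_of_indexFormula`, Prop. 14).
* `Literature.NumberTheory.GaloisRepresentations.exists_mul_mul_mem_inertia_of_finite`, `Literature.NumberTheory.GaloisRepresentations.map_inertia_restrictNormalHom`: inertia
  surjects (finite-group version of `InertiaLift.lean`, from Mathlib's
  `Algebra.IsInvariant.exists_smul_of_under_eq` and `Ideal.Quotient.stabilizerHom_surjective`).
* `Literature.NumberTheory.GaloisRepresentations.upperRamificationSubgroup_eq_map_restrictNormalHom_of_indexFormula`: the statement of the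
  named fact `Literature.NumberTheory.GaloisRepresentations.herbrand_quotient` at a maximal ideal `𝔓`, from the index formula at `𝔓`
  (Serre Ch. IV §1 Prop. 3; proved in `RamificationFiltrationHerbrandQuotientProofs.lean`).

## Proof architecture (Serre, Ch. IV §3, pp. 74–76, followed literally except for Prop. 15)

Lemma 4: for `s ∈ G_0 ∖ H` maximising `i_G` on its coset `sH` (`i_G(s) = j(σ) = m`),
`i_G(st) = inf(i_H(t), m)` for `t ∈ H`, so by Prop. 3 and Lemma 3 for `H`,
`Card(H_0) i_{G/H}(σ) = Σ_t inf(i_H(t), m) = Card(H_0)(φ_H(m-1) + 1)`.  Lemma 5 then follows as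
in Serre by monotonicity of `φ_H` and integrality (`⌈·⌉₊`).  Prop. 15 is proved without
derivatives: both sides are the identity on `(-∞, 0]` and, by induction on `n`, agree on
`[n, n+1]`, where `φ_G` is affine of slope `#G_{n+1}/#G_0` (`herbrandPhi_eq_of_mem_Icc`) while on
`φ_H([n, n+1])` the integrand of `φ_Q` is the constant `#Q_{n'}/#Q_0` with
`Q_{n'} = π(G_{n+1})` by Lemma 5, and `#π(G_{n+1}) · #H_{n+1} = #G_{n+1}`,
`#Q_0 · #H_0 = #G_0`.  Prop. 14: `Q^v = Q_{ψ_Q v} = π(G_u)` with `φ_H(u) = ψ_Q(v)` and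
`u = ψ_G(v)` by Prop. 15.

The index formula itself (Serre's Prop. 3 in the global Dedekind setting: Tate's argument with an
"index element" replacing the generator of `A_L`, and `e_{L/E}(𝔓) = Card(H_0)` under residue
separability) is proved in `RamificationFiltrationHerbrandQuotientProofs.lean`, which concludes
`herbrand_quotient_holds`.

## References

* J.-P. Serre, *Local Fields*, GTM 67, Springer 1979: Ch. IV §1, pp. 61–65 (`i_G`, Prop. 2,
  Prop. 3, Remark 2 on the global case); Ch. IV §3, pp. 73–76 (Lemmas 3–5, Prop. 14, Prop. 15);
  Ch. I §7, Prop. 22 b) (inertia groups in towers). [SerreLocalFields1979]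
* J. Neukirch, *Algebraic Number Theory*, Springer 1999, Ch. II §10, (10.5)–(10.7).
  [NeukirchANT1999]
-/

noncomputable section

open MeasureTheory Set Filter
open scoped Pointwise

namespace Literature.NumberTheory.GaloisRepresentations

/-! ### An `ℕ∞` helper -/

/-- If every `i + 1 ≤ a` (`i : ℕ`) forces `i + 1 ≤ b`, then `a ≤ b` in `ℕ∞`. [folklore] -/
theorem ENat.le_of_forall_natCast_add_one_le {a b : ℕ∞}
    (h : ∀ i : ℕ, (i : ℕ∞) + 1 ≤ a → (i : ℕ∞) + 1 ≤ b) : a ≤ b := by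
  induction b using ENat.recTopCoe with
  | top => exact le_top
  | coe n =>
    induction a using ENat.recTopCoe with
    | top =>
      have := h n le_top
      exact absurd (by exact_mod_cast this) (Nat.lt_irrefl n)
    | coe m =>
      by_contra hmn
      have hnm : n < m := by simpa using not_le.mp hmn
      have := h n (by exact_mod_cast hnm)
      exact absurd (by exact_mod_cast this) (Nat.lt_irrefl n)

variable {S : Type*} [CommRing S] (𝔓 : Ideal S) (G : Type*) [Group G] [MulSemiringAction G S]

/-! ### Serre's function `i_G` -/

section LowerIndex

/-- Serre's function `i_G` on `G`, defined from the lower-numbering filtration as its order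
function shifted by one: `lowerIndex 𝔓 G s = sup {i + 1 | s ∈ G_i} ∈ ℕ∞`, so that
`s ∈ G_i ↔ i + 1 ≤ i_G(s)` (`add_one_le_lowerIndex_iff`), `i_G(1) = ⊤`, and `i_G(s) = 0` iff
`s ∉ G_0`.  In Serre's local setting (`A_L = A_K[x]`) this is `i_G(s) = v_L(s x - x)`; Serre notes
that `i_G` "is equal to the order function of the filtration `(G_i)`, increased by one unit".
Ref: Serre, *Local Fields*, Ch. IV §1, p. 62 (definition of `i_G` and
`i_G(s) ≥ i + 1 ⇔ s ∈ G_i`). [cite: SerreLocalFields1979, Ch. IV §1 (p. 62)] -/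
def lowerIndex (s : G) : ℕ∞ :=
  ⨆ (i : ℕ) (_ : s ∈ 𝔓.ramificationSubgroup G i), ((i : ℕ∞) + 1)

variable {G}

/-- `s ∈ G_i → i + 1 ≤ i_G(s)`.  Ref: Serre, *Local Fields*, Ch. IV §1, p. 62. [folklore] -/
theorem add_one_le_lowerIndex {s : G} {i : ℕ} (h : s ∈ 𝔓.ramificationSubgroup G i) :
    (i : ℕ∞) + 1 ≤ lowerIndex 𝔓 G s :=
  le_iSup₂_of_le (f := fun (i : ℕ) (_ : s ∈ 𝔓.ramificationSubgroup G i) => ((i : ℕ∞) + 1)) i h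
    le_rfl

/-- `i_G(s) ≥ i + 1 ⇔ s ∈ G_i` (Serre's first property of `i_G`).
Ref: Serre, *Local Fields*, Ch. IV §1, p. 62. [cite: SerreLocalFields1979, Ch. IV §1 (p. 62)] -/
theorem add_one_le_lowerIndex_iff {s : G} {i : ℕ} :
    (i : ℕ∞) + 1 ≤ lowerIndex 𝔓 G s ↔ s ∈ 𝔓.ramificationSubgroup G i := by
  refine ⟨fun h => ?_, add_one_le_lowerIndex 𝔓⟩
  by_contra hs
  have hle : lowerIndex 𝔓 G s ≤ i := by
    refine iSup₂_le fun j hj => ?_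
    have hji : j < i := by
      by_contra hji
      exact hs (𝔓.ramificationSubgroup_antitone G (not_lt.mp hji) hj)
    exact_mod_cast Nat.succ_le_of_lt hji
  have : ((i + 1 : ℕ) : ℕ∞) ≤ (i : ℕ∞) := by
    push_cast
    exact h.trans hle
  exact absurd (Nat.cast_le.mp this) (by omega)

/-- `i < i_G(s) ⇔ s ∈ G_i` (`i : ℕ`).  Ref: Serre, *Local Fields*, Ch. IV §1, p. 62. [folklore] -/
theorem natCast_lt_lowerIndex_iff {s : G} {i : ℕ} :
    (i : ℕ∞) < lowerIndex 𝔓 G s ↔ s ∈ 𝔓.ramificationSubgroup G i := by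
  rw [← add_one_le_lowerIndex_iff, ENat.add_one_le_iff (ENat.coe_ne_top i)]

/-- `i_G(s) ≤ i ⇔ s ∉ G_i` (`i : ℕ`).  Ref: Serre, *Local Fields*, Ch. IV §1, p. 62. [folklore] -/
theorem lowerIndex_le_natCast_iff {s : G} {i : ℕ} :
    lowerIndex 𝔓 G s ≤ i ↔ s ∉ 𝔓.ramificationSubgroup G i := by
  rw [← natCast_lt_lowerIndex_iff, not_lt]

/-- `1 ≤ i_G(s) ⇔ s ∈ G_0`.  Ref: Serre, *Local Fields*, Ch. IV §1, p. 62. [folklore] -/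
theorem one_le_lowerIndex_iff {s : G} : 1 ≤ lowerIndex 𝔓 G s ↔ s ∈ 𝔓.ramificationSubgroup G 0 := by
  rw [← add_one_le_lowerIndex_iff, Nat.cast_zero, zero_add]

/-- `i_G(s) = 0 ⇔ s ∉ G_0`.  Ref: Serre, *Local Fields*, Ch. IV §1, p. 62. [folklore] -/
theorem lowerIndex_eq_zero_iff {s : G} : lowerIndex 𝔓 G s = 0 ↔ s ∉ 𝔓.ramificationSubgroup G 0 := by
  rw [← lowerIndex_le_natCast_iff, Nat.cast_zero, nonpos_iff_eq_zero]

/-- `i_G(s) = ⊤ ⇔ s ∈ G_i` for all `i`.  Ref: Serre, *Local Fields*, Ch. IV §1, p. 62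
(`i_G(1) = +∞`). [folklore] -/
theorem lowerIndex_eq_top_iff {s : G} :
    lowerIndex 𝔓 G s = ⊤ ↔ ∀ i, s ∈ 𝔓.ramificationSubgroup G i := by
  constructor
  · intro h i
    exact (add_one_le_lowerIndex_iff 𝔓).mp (h ▸ le_top)
  · intro h
    by_contra hne
    obtain ⟨n, hn⟩ := ENat.ne_top_iff_exists.mp hne
    have := add_one_le_lowerIndex 𝔓 (h n)
    rw [← hn] at this
    exact absurd (by exact_mod_cast this) (Nat.lt_irrefl n)

/-- `i_G(1) = ⊤`.  Ref: Serre, *Local Fields*, Ch. IV §1, p. 62. [cite: SerreLocalFields1979, Ch. IV §1 (p. 62)] -/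
@[simp]
theorem lowerIndex_one : lowerIndex 𝔓 G 1 = ⊤ :=
  (lowerIndex_eq_top_iff 𝔓).mpr fun _ => Subgroup.one_mem _

/-- If some `G_N` is trivial, `i_G(s) < ⊤` for `s ≠ 1`.
Ref: Serre, *Local Fields*, Ch. IV §1, p. 62 ("if `s ≠ 1`, `i_G(s)` is a non-negative integer"). [folklore] -/
theorem lowerIndex_ne_top {N : ℕ} (hN : 𝔓.ramificationSubgroup G N = ⊥) {s : G} (hs : s ≠ 1) :
    lowerIndex 𝔓 G s ≠ ⊤ := fun h =>
  hs (Subgroup.mem_bot.mp (hN ▸ (lowerIndex_eq_top_iff 𝔓).mp h N))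

/-- `i_G(s⁻¹) = i_G(s)`.  Ref: Serre, *Local Fields*, Ch. IV §1, p. 62. [folklore] -/
@[simp]
theorem lowerIndex_inv (s : G) : lowerIndex 𝔓 G s⁻¹ = lowerIndex 𝔓 G s := by
  simp only [lowerIndex, inv_mem_iff]

/-- `i_G(s t) ≥ inf(i_G(s), i_G(t))` (Serre's third property of `i_G`).
Ref: Serre, *Local Fields*, Ch. IV §1, p. 62. [cite: SerreLocalFields1979, Ch. IV §1 (p. 62)] -/
theorem min_lowerIndex_le_lowerIndex_mul (s t : G) :
    min (lowerIndex 𝔓 G s) (lowerIndex 𝔓 G t) ≤ lowerIndex 𝔓 G (s * t) := by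
  refine ENat.le_of_forall_natCast_add_one_le fun i hi => ?_
  rw [le_min_iff, add_one_le_lowerIndex_iff, add_one_le_lowerIndex_iff] at hi
  exact add_one_le_lowerIndex 𝔓 (Subgroup.mul_mem _ hi.1 hi.2)

/-- `i_G(t s t⁻¹) = i_G(s)` for `t` in the decomposition group (the `G_i` are normal in `D_𝔓`;
Serre's second property of `i_G`).  Ref: Serre, *Local Fields*, Ch. IV §1, p. 62. [cite: SerreLocalFields1979, Ch. IV §1 (p. 62)] -/
theorem lowerIndex_conj {s t : G} (ht : t ∈ 𝔓.decompositionSubgroup G) :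
    lowerIndex 𝔓 G (t * s * t⁻¹) = lowerIndex 𝔓 G s := by
  refine le_antisymm (ENat.le_of_forall_natCast_add_one_le fun i hi => ?_)
    (ENat.le_of_forall_natCast_add_one_le fun i hi => ?_)
  · rw [add_one_le_lowerIndex_iff] at hi ⊢
    have h := 𝔓.ramificationSubgroup_conj_mem G hi (Subgroup.inv_mem _ ht)
    simpa [mul_assoc] using h
  · rw [add_one_le_lowerIndex_iff] at hi ⊢
    exact 𝔓.ramificationSubgroup_conj_mem G hi ht

/-- If `i_G(t) < i_G(s)` then `i_G(s t) = i_G(t)`.  Ref: Serre, *Local Fields*, Ch. IV §3,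
proof of Lemma 4, p. 75. [folklore] -/
theorem lowerIndex_mul_eq_right_of_lt {s t : G} (h : lowerIndex 𝔓 G t < lowerIndex 𝔓 G s) :
    lowerIndex 𝔓 G (s * t) = lowerIndex 𝔓 G t := by
  refine le_antisymm ?_ (by simpa [min_eq_right h.le] using min_lowerIndex_le_lowerIndex_mul 𝔓 s t)
  -- `t = s⁻¹ (s t)`, so `i(t) ≥ min (i(s), i(s t))`; if `i(s t) > i(t)` this exceeds `i(t)`.
  by_contra hlt
  have h' := min_lowerIndex_le_lowerIndex_mul 𝔓 s⁻¹ (s * t)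
  rw [inv_mul_cancel_left, lowerIndex_inv] at h'
  have : min (lowerIndex 𝔓 G s) (lowerIndex 𝔓 G (s * t)) > lowerIndex 𝔓 G t :=
    lt_min h (not_le.mp hlt)
  exact absurd h' (not_le.mpr this)

end LowerIndex

/-! ### The filtration of a subgroup (Serre, Ch. IV §1, Prop. 2) -/

section SubgroupFiltration

variable {G}
variable (H : Subgroup G)

/-- For a subgroup `H ≤ G` (acting on `S` by restriction), `H_i = G_i ∩ H`.
Ref: Serre, *Local Fields*, Ch. IV §1, Prop. 2. [cite: SerreLocalFields1979, Ch. IV §1 Prop. 2] -/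
theorem mem_ramificationSubgroup_subgroup_iff {σ : H} {i : ℕ} :
    σ ∈ 𝔓.ramificationSubgroup H i ↔ (σ : G) ∈ 𝔓.ramificationSubgroup G i :=
  Iff.rfl

/-- For a subgroup `H ≤ G`, `H_i = G_i ∩ H` as subgroups of `H`.
Ref: Serre, *Local Fields*, Ch. IV §1, Prop. 2. [cite: SerreLocalFields1979, Ch. IV §1 Prop. 2] -/
theorem ramificationSubgroup_subgroup (i : ℕ) :
    𝔓.ramificationSubgroup H i = (𝔓.ramificationSubgroup G i).subgroupOf H :=
  Subgroup.ext fun _ => mem_ramificationSubgroup_subgroup_iff 𝔓 H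

/-- For a subgroup `H ≤ G` and `s ∈ H`, `i_H(s) = i_G(s)`.
Ref: Serre, *Local Fields*, Ch. IV §1, Prop. 2. [cite: SerreLocalFields1979, Ch. IV §1 Prop. 2] -/
theorem lowerIndex_subgroup (σ : H) : lowerIndex 𝔓 H σ = lowerIndex 𝔓 G (σ : G) := by
  simp only [lowerIndex, mem_ramificationSubgroup_subgroup_iff]

end SubgroupFiltration

/-! ### Lemma 3 at integers: `Σ_{s ∈ G} inf(i_G(s), m + 1) = Σ_{i=0}^{m} g_i` -/

section Lemma3

/-- Layer-cake identity in `ℕ∞`: `inf(x, m + 1) = Σ_{i=0}^{m} [i + 1 ≤ x]`. [folklore] -/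
theorem ENat.min_natCast_add_one_eq_sum (x : ℕ∞) (m : ℕ) :
    min x ((m : ℕ∞) + 1) = ∑ i ∈ Finset.range (m + 1), if (i : ℕ∞) + 1 ≤ x then 1 else 0 := by
  induction m with
  | zero =>
    rw [Finset.sum_range_one, Nat.cast_zero, zero_add]
    split_ifs with h
    · exact min_eq_right h
    · rw [Order.lt_one_iff.mp (not_le.mp h)]
      simp
  | succ m ih =>
    rw [Finset.sum_range_succ, ← ih]
    induction x using ENat.recTopCoe with
    | top => simp
    | coe k =>
      split_ifs with h
      · have h' : m + 1 + 1 ≤ k := by exact_mod_cast h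
        rw [min_eq_right (by exact_mod_cast h'), min_eq_right (by exact_mod_cast (by omega : m + 1 ≤ k))]
        push_cast
        ring
      · have h' : ¬ (m + 1 + 1 ≤ k) := fun h'' => h (by exact_mod_cast h'')
        rw [min_eq_left (by exact_mod_cast (by omega : k ≤ m + 1 + 1)),
          min_eq_left (by exact_mod_cast (by omega : k ≤ m + 1)), add_zero]

variable {G} [Finite G]

/-- **Serre's Lemma 3 at integer arguments.**  `Σ_{s ∈ G} inf(i_G(s), m + 1) = Σ_{i=0}^{m} #G_i`
for `m : ℕ`; with `#G_0 (φ(m) + 1) = Σ_{i=0}^{m} #G_i` (`card_mul_herbrandPhi_natCast_add_one`)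
this is Lemma 3, `φ(u) = (1/g₀) Σ_{s ∈ G} inf(i_G(s), u + 1) - 1`, at `u = m` (terms with
`s ∉ G_0` vanish).  Ref: Serre, *Local Fields*, Ch. IV §3, Lemma 3, p. 74. [cite: SerreLocalFields1979, Ch. IV §3 Lemma 3 (p. 74)] -/
theorem finsum_min_lowerIndex (m : ℕ) :
    ∑ᶠ s : G, min (lowerIndex 𝔓 G s) ((m : ℕ∞) + 1) =
      ((∑ i ∈ Finset.range (m + 1), Nat.card (𝔓.ramificationSubgroup G i) : ℕ) : ℕ∞) := by
  classical
  haveI := Fintype.ofFinite G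
  rw [finsum_eq_sum_of_fintype]
  simp_rw [ENat.min_natCast_add_one_eq_sum, add_one_le_lowerIndex_iff]
  rw [Finset.sum_comm, Nat.cast_sum]
  refine Finset.sum_congr rfl fun i _ => ?_
  rw [Finset.sum_boole, Nat.cast_inj, Nat.card_eq_fintype_card, Fintype.card_subtype]

/-- Lemma 3 at integers in terms of `φ`: `Σ_{s ∈ G} inf(i_G(s), m + 1) = #G_0 (φ(m) + 1)` (as real
numbers).  Ref: Serre, *Local Fields*, Ch. IV §3, Lemma 3, p. 74. [cite: SerreLocalFields1979, Ch. IV §3 Lemma 3 (p. 74)] -/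
theorem finsum_min_lowerIndex_eq_card_mul_herbrandPhi (m : ℕ) :
    ∃ N : ℕ, ∑ᶠ s : G, min (lowerIndex 𝔓 G s) ((m : ℕ∞) + 1) = N ∧
      (N : ℝ) = Nat.card (𝔓.ramificationSubgroup G 0) * (herbrandPhi 𝔓 G m + 1) :=
  ⟨_, finsum_min_lowerIndex 𝔓 m, by rw [card_mul_herbrandPhi_natCast_add_one, Nat.cast_sum]⟩

end Lemma3

/-! ### Quotients: Lemma 4, Herbrand's theorem (Lemma 5), transitivity (Prop. 15), Prop. 14

Abstract setting: `π : G →* Q` a homomorphism of groups, `G` acting on `(S, 𝔓)` and `Q` acting on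
`(S', 𝔮)`; `H = ker π` acts on `S` by restriction, so `herbrandPhi 𝔓 H` is Serre's `φ_{L/K'}`
(`H_i = G_i ∩ H`, Prop. 2).  The arithmetic enters only through the hypotheses
`(G_0).map π = Q_0` (inertia surjects, Serre Ch. I §7 Prop. 22 b)) and `IndexFormula`
(Serre Ch. IV §1 Prop. 3, with `e' = Card H_0`). -/

section Quotient

variable {G}
variable {S' : Type*} [CommRing S'] (𝔮 : Ideal S') {Q : Type*} [Group Q] [MulSemiringAction Q S']
  (π : G →* Q)

/-- **Serre's Prop. 3 as a hypothesis** on the pair of filtrations along `π : G →* Q`: for every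
`s ∈ G_0` not in `H = ker π`, `Card(H_0) · i_Q(π s) = Σ_{t ∈ H} i_G(s t)` (in `ℕ∞`).  In Serre:
`i_{G/H}(σ) = (1/e') Σ_{s → σ} i_G(s)` with `e' = e_{L/K'} = Card(H_0)` (the latter equality is
Ch. I §7 Cor. to Prop. 21, separable residue extension).
Ref: Serre, *Local Fields*, Ch. IV §1, Prop. 3, p. 63. [cite: SerreLocalFields1979, Ch. IV §1 Prop. 3 (p. 63)] -/
def IndexFormula : Prop :=
  ∀ s ∈ 𝔓.ramificationSubgroup G 0, s ∉ π.ker →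
    (Nat.card (𝔓.ramificationSubgroup π.ker 0) : ℕ∞) * lowerIndex 𝔮 Q (π s) =
      ∑ᶠ t : π.ker, lowerIndex 𝔓 G (s * t)

variable [Finite G]

/-- Every coset `s₀ H` (`H = ker π`) contains an element maximising `i_G`.
Ref: Serre, *Local Fields*, Ch. IV §3, Lemma 4, p. 75 (`j(σ) = sup_{s→σ} i_G(s)` is attained). [folklore] -/
theorem exists_max_lowerIndex_mul (s₀ : G) :
    ∃ t₀ ∈ π.ker, ∀ t ∈ π.ker, lowerIndex 𝔓 G (s₀ * t) ≤ lowerIndex 𝔓 G (s₀ * t₀) := by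
  obtain ⟨t₀, ht₀⟩ := Finite.exists_max fun t : π.ker => lowerIndex 𝔓 G (s₀ * t)
  exact ⟨t₀, t₀.2, fun t ht => ht₀ ⟨t, ht⟩⟩

/-- **Serre's Lemma 4** (for a maximising representative).  Let `s ∈ G_0`, `s ∉ H = ker π`, with
`i_G(s) = sup_{t ∈ H} i_G(s t)` (`= j(π s)`).  Then `i_G(s) = k + 1` and `i_Q(π s) = n` are
finite and `n = φ_{H}(k) + 1`, i.e. `i_{G/H}(σ) - 1 = φ_{L/K'}(j(σ) - 1)`; here under the
hypotheses `IndexFormula` (Prop. 3) and `G_N = 1` for some `N`.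
Ref: Serre, *Local Fields*, Ch. IV §3, Lemma 4, p. 75. [cite: SerreLocalFields1979, Ch. IV §3 Lemma 4 (p. 75)] -/
theorem lowerIndex_map_eq_of_max (h3 : IndexFormula 𝔓 𝔮 π) {N : ℕ}
    (hN : 𝔓.ramificationSubgroup G N = ⊥) {s : G} (hs0 : s ∈ 𝔓.ramificationSubgroup G 0)
    (hsH : s ∉ π.ker) (hmax : ∀ t ∈ π.ker, lowerIndex 𝔓 G (s * t) ≤ lowerIndex 𝔓 G s) :
    ∃ k n : ℕ, lowerIndex 𝔓 G s = k + 1 ∧ lowerIndex 𝔮 Q (π s) = n ∧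
      (n : ℝ) = herbrandPhi 𝔓 π.ker k + 1 := by
  -- `i_G(s) = k + 1` is finite and positive
  have hs1 : s ≠ 1 := fun h => hsH (h ▸ Subgroup.one_mem _)
  obtain ⟨m, hm⟩ := ENat.ne_top_iff_exists.mp (lowerIndex_ne_top 𝔓 hN hs1)
  have hm1 : 1 ≤ m := by
    have := (one_le_lowerIndex_iff 𝔓).mpr hs0
    rw [← hm] at this
    exact_mod_cast this
  obtain ⟨k, rfl⟩ : ∃ k, m = k + 1 := ⟨m - 1, by omega⟩
  have hk : lowerIndex 𝔓 G s = k + 1 := by rw [← hm]; push_cast; rfl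
  -- `i_G(s t) = inf(i_H(t), k + 1)` for `t ∈ H`
  have hpt : ∀ t : π.ker, lowerIndex 𝔓 G (s * t) = min (lowerIndex 𝔓 π.ker t) ((k : ℕ∞) + 1) := by
    intro t
    rw [lowerIndex_subgroup, ← hk]
    rcases lt_or_ge (lowerIndex 𝔓 G (t : G)) (lowerIndex 𝔓 G s) with h | h
    · rw [lowerIndex_mul_eq_right_of_lt 𝔓 h, min_eq_left h.le]
    · rw [min_eq_right h]
      refine le_antisymm (hmax t t.2) ?_
      simpa [min_eq_left h] using min_lowerIndex_le_lowerIndex_mul 𝔓 s (t : G)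
  -- sum over `H` by Lemma 3 for `H`
  obtain ⟨N₁, hN₁, hN₁real⟩ := finsum_min_lowerIndex_eq_card_mul_herbrandPhi 𝔓 (G := π.ker) k
  have hsum : ∑ᶠ t : π.ker, lowerIndex 𝔓 G (s * t) = N₁ := by
    rw [← hN₁]
    exact finsum_congr hpt
  -- Prop. 3
  have h := h3 s hs0 hsH
  rw [hsum] at h
  have hcard : (Nat.card (𝔓.ramificationSubgroup π.ker 0) : ℕ∞) ≠ 0 :=
    Nat.cast_ne_zero.mpr (Nat.card_pos (α := 𝔓.ramificationSubgroup π.ker 0)).ne'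
  have hfin : lowerIndex 𝔮 Q (π s) ≠ ⊤ := by
    intro htop
    rw [htop, ENat.mul_top hcard] at h
    exact ENat.coe_ne_top N₁ h.symm
  obtain ⟨n, hn⟩ := ENat.ne_top_iff_exists.mp hfin
  refine ⟨k, n, hk, hn.symm, ?_⟩
  rw [← hn] at h
  have h' : Nat.card (𝔓.ramificationSubgroup π.ker 0) * n = N₁ := by exact_mod_cast h
  have h'' : (Nat.card (𝔓.ramificationSubgroup π.ker 0) : ℝ) * n = N₁ := by exact_mod_cast h'
  rw [hN₁real] at h''
  have hcard' : (0 : ℝ) < Nat.card (𝔓.ramificationSubgroup π.ker 0) :=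
    Nat.cast_pos.mpr (Nat.card_pos (α := 𝔓.ramificationSubgroup π.ker 0))
  exact mul_left_cancel₀ hcard'.ne' h''

/-- Lemma 4, existence form: for `s₀ ∈ G_0 ∖ H` there is `s ∈ s₀ H` with `i_G(s) = k + 1 ≥ i_G(s₀)`
(`= j(π s₀)`), `i_Q(π s₀) = n` and `n = φ_H(k) + 1`.
Ref: Serre, *Local Fields*, Ch. IV §3, Lemma 4, p. 75. [cite: SerreLocalFields1979, Ch. IV §3 Lemma 4 (p. 75)] -/
theorem exists_rep_lowerIndex_map_eq (h3 : IndexFormula 𝔓 𝔮 π) {N : ℕ}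
    (hN : 𝔓.ramificationSubgroup G N = ⊥) {s₀ : G} (hs₀ : s₀ ∈ 𝔓.ramificationSubgroup G 0)
    (hs₀H : s₀ ∉ π.ker) :
    ∃ s : G, π s = π s₀ ∧ lowerIndex 𝔓 G s₀ ≤ lowerIndex 𝔓 G s ∧
      ∃ k n : ℕ, lowerIndex 𝔓 G s = k + 1 ∧ lowerIndex 𝔮 Q (π s₀) = n ∧
        (n : ℝ) = herbrandPhi 𝔓 π.ker k + 1 := by
  obtain ⟨t₀, ht₀, hmax⟩ := exists_max_lowerIndex_mul 𝔓 π s₀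
  have hπs : π (s₀ * t₀) = π s₀ := by rw [map_mul, MonoidHom.mem_ker.mp ht₀, mul_one]
  have hle : lowerIndex 𝔓 G s₀ ≤ lowerIndex 𝔓 G (s₀ * t₀) := by
    simpa using hmax 1 (Subgroup.one_mem _)
  have hsH : s₀ * t₀ ∉ π.ker := fun h => hs₀H (by simpa using π.ker.mul_mem h (π.ker.inv_mem ht₀))
  have hs0 : s₀ * t₀ ∈ 𝔓.ramificationSubgroup G 0 :=
    (one_le_lowerIndex_iff 𝔓).mp (((one_le_lowerIndex_iff 𝔓).mpr hs₀).trans hle)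
  have hmax' : ∀ t ∈ π.ker, lowerIndex 𝔓 G (s₀ * t₀ * t) ≤ lowerIndex 𝔓 G (s₀ * t₀) := fun t ht => by
    rw [mul_assoc]
    exact hmax _ (π.ker.mul_mem ht₀ ht)
  obtain ⟨k, n, hk, hn, hreal⟩ := lowerIndex_map_eq_of_max 𝔓 𝔮 π h3 hN hs0 hsH hmax'
  exact ⟨s₀ * t₀, hπs, hle, k, n, hk, hπs ▸ hn, hreal⟩

/-- **Herbrand's theorem** (Serre's Lemma 5), abstract form: if `(G_0).map π = Q_0`, some `G_N`
is trivial and the index formula (Prop. 3) holds, then for every real `u`,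
`π(G_u) = Q_{φ_H(u)}`, i.e. `G_u H/H = (G/H)_v` with `v = φ_{L/K'}(u)` (non-integral indices
rounded up: `G_u = G_{⌈u⌉₊}`).
Ref: Serre, *Local Fields*, Ch. IV §3, Lemma 5, p. 75 ("usually called Herbrand's theorem"). [cite: SerreLocalFields1979, Ch. IV §3 Lemma 5 (p. 75)] -/
theorem map_ramificationSubgroup_eq_of_indexFormula
    (hI : (𝔓.ramificationSubgroup G 0).map π = 𝔮.ramificationSubgroup Q 0) {N : ℕ}
    (hN : 𝔓.ramificationSubgroup G N = ⊥) (h3 : IndexFormula 𝔓 𝔮 π) (u : ℝ) :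
    (𝔓.ramificationSubgroup G ⌈u⌉₊).map π =
      𝔮.ramificationSubgroup Q ⌈herbrandPhi 𝔓 π.ker u⌉₊ := by
  apply le_antisymm
  · rintro σ ⟨s', hs', rfl⟩
    by_cases hs'H : s' ∈ π.ker
    · rw [MonoidHom.mem_ker.mp hs'H]
      exact Subgroup.one_mem _
    have hs'0 : s' ∈ 𝔓.ramificationSubgroup G 0 := 𝔓.ramificationSubgroup_antitone G (Nat.zero_le _) hs'
    obtain ⟨s, hπs, hle, k, n, hk, hn, hreal⟩ := exists_rep_lowerIndex_map_eq 𝔓 𝔮 π h3 hN hs'0 hs'H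
    -- `⌈u⌉₊ ≤ k`
    have hku : ⌈u⌉₊ ≤ k := by
      have h := ((add_one_le_lowerIndex_iff 𝔓).mpr hs').trans hle
      rw [hk] at h
      have : ⌈u⌉₊ + 1 ≤ k + 1 := by exact_mod_cast h
      omega
    -- `φ_H u ≤ n - 1`
    have hφ : herbrandPhi 𝔓 π.ker u ≤ herbrandPhi 𝔓 π.ker k :=
      herbrandPhi_mono 𝔓 _ ((Nat.le_ceil u).trans (by exact_mod_cast hku))
    have hn1 : 1 ≤ n := by
      have : (0 : ℝ) ≤ herbrandPhi 𝔓 π.ker k := (herbrandPhi_nonneg_iff 𝔓 _).mpr (Nat.cast_nonneg k)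
      have : (1 : ℝ) ≤ n := by linarith
      exact_mod_cast this
    have hceil : ⌈herbrandPhi 𝔓 π.ker u⌉₊ ≤ n - 1 := by
      refine Nat.ceil_le.mpr ?_
      rw [Nat.cast_sub hn1, Nat.cast_one]
      linarith
    refine (add_one_le_lowerIndex_iff 𝔮).mp ?_
    rw [hn]
    have : ⌈herbrandPhi 𝔓 π.ker u⌉₊ + 1 ≤ n := by omega
    exact_mod_cast this
  · intro σ hσ
    have hσ0 : σ ∈ (𝔓.ramificationSubgroup G 0).map π :=
      hI ▸ 𝔮.ramificationSubgroup_antitone Q (Nat.zero_le _) hσ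
    obtain ⟨s₀, hs₀, rfl⟩ := hσ0
    by_cases hs₀H : s₀ ∈ π.ker
    · exact ⟨1, Subgroup.one_mem _, by rw [map_one, MonoidHom.mem_ker.mp hs₀H]⟩
    obtain ⟨s, hπs, -, k, n, hk, hn, hreal⟩ := exists_rep_lowerIndex_map_eq 𝔓 𝔮 π h3 hN hs₀ hs₀H
    refine ⟨s, ?_, hπs⟩
    have h1 : ⌈herbrandPhi 𝔓 π.ker u⌉₊ + 1 ≤ n := by
      have h := (add_one_le_lowerIndex_iff 𝔮).mpr hσ
      rw [hn] at h
      exact_mod_cast h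
    have h2 : herbrandPhi 𝔓 π.ker u ≤ herbrandPhi 𝔓 π.ker k := by
      have h1' : (⌈herbrandPhi 𝔓 π.ker u⌉₊ : ℝ) + 1 ≤ n := by exact_mod_cast h1
      linarith [Nat.le_ceil (herbrandPhi 𝔓 π.ker u)]
    have h4 : ⌈u⌉₊ ≤ k := Nat.ceil_le.mpr ((herbrandPhi_strictMono 𝔓 _).le_iff_le.mp h2)
    refine (add_one_le_lowerIndex_iff 𝔓).mp ?_
    rw [hk]
    exact_mod_cast Nat.succ_le_succ h4

/-- `A ⊓ B`, viewed as a subgroup of `B` or of `A`, has the same cardinality. [folklore] -/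
theorem _root_.Subgroup.card_subgroupOf_comm {G : Type*} [Group G] (A B : Subgroup G) :
    Nat.card (A.subgroupOf B) = Nat.card (B.subgroupOf A) :=
  Nat.card_congr
    { toFun := fun x => ⟨⟨x.1.1, x.2⟩, x.1.2⟩
      invFun := fun x => ⟨⟨x.1.1, x.2⟩, x.1.2⟩
      left_inv := fun _ => rfl
      right_inv := fun _ => rfl }

omit [Finite G] in
/-- `Card(G_n H/H) · Card(H_n) = Card(G_n)` for `H = ker π` (`H_n = G_n ∩ H`).
Ref: Serre, *Local Fields*, Ch. IV §3, proof of Prop. 15, p. 75–76. [folklore] -/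
theorem card_map_mul_card_ramificationSubgroup_ker (n : ℕ) :
    Nat.card ((𝔓.ramificationSubgroup G n).map π) * Nat.card (𝔓.ramificationSubgroup π.ker n) =
      Nat.card (𝔓.ramificationSubgroup G n) := by
  have h := Subgroup.card_mul_index (π.restrict (𝔓.ramificationSubgroup G n)).ker
  rw [Subgroup.index_ker, MonoidHom.restrict_range, MonoidHom.ker_restrict] at h
  rw [ramificationSubgroup_subgroup, Subgroup.card_subgroupOf_comm, mul_comm]
  exact h

variable [Finite Q]

/-- **Transitivity of `φ`** (Serre's Prop. 15), abstract form: under the hypotheses of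
`map_ramificationSubgroup_eq_of_indexFormula`, `φ_G = φ_Q ∘ φ_H`
(`φ_{L/K} = φ_{K'/K} ∘ φ_{L/K'}`).  Proof: both sides vanish at `0`, are the identity on
`(-∞, 0]`, and are affine on each `[n, n+1]` with the same slope `#G_{n+1}/#G_0`: on
`φ_H([n, n+1])` the integrand of `φ_Q` is the constant `#(G_{n+1}H/H)/#(G_0H/H)` by Herbrand's
theorem, and `#(G_{n+1}H/H) · #H_{n+1} = #G_{n+1}`.
Ref: Serre, *Local Fields*, Ch. IV §3, Prop. 15, p. 74–76. [cite: SerreLocalFields1979, Ch. IV §3 Prop. 15 (pp. 74–76)] -/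
theorem herbrandPhi_eq_herbrandPhi_comp_of_indexFormula
    (hI : (𝔓.ramificationSubgroup G 0).map π = 𝔮.ramificationSubgroup Q 0) {N : ℕ}
    (hN : 𝔓.ramificationSubgroup G N = ⊥) (h3 : IndexFormula 𝔓 𝔮 π) (u : ℝ) :
    herbrandPhi 𝔓 G u = herbrandPhi 𝔮 Q (herbrandPhi 𝔓 π.ker u) := by
  -- notation for the cardinalities
  set gG : ℕ → ℝ := fun n => (Nat.card (𝔓.ramificationSubgroup G n) : ℝ) with hgG
  set gH : ℕ → ℝ := fun n => (Nat.card (𝔓.ramificationSubgroup π.ker n) : ℝ) with hgH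
  set gQ : ℕ → ℝ := fun n => (Nat.card (𝔮.ramificationSubgroup Q n) : ℝ) with hgQ
  set gM : ℕ → ℝ := fun n => (Nat.card ((𝔓.ramificationSubgroup G n).map π) : ℝ) with hgM
  have hMH : ∀ n, gM n * gH n = gG n := fun n => by
    simp only [hgM, hgH, hgG]
    exact_mod_cast card_map_mul_card_ramificationSubgroup_ker 𝔓 π n
  have hQ0 : gQ 0 = gM 0 := by simp only [hgQ, hgM, hI]
  have hG0 : gG 0 ≠ 0 := (Nat.cast_pos.mpr (Nat.card_pos (α := 𝔓.ramificationSubgroup G 0))).ne'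
  have hH0 : gH 0 ≠ 0 := (Nat.cast_pos.mpr (Nat.card_pos (α := 𝔓.ramificationSubgroup π.ker 0))).ne'
  have hM0 : gM 0 ≠ 0 := fun h => hG0 (by rw [← hMH 0, h, zero_mul])
  have hslope : ∀ n, gH (n + 1) / gH 0 * (gM (n + 1) / gQ 0) = gG (n + 1) / gG 0 := fun n => by
    rw [hQ0, div_mul_div_comm, mul_comm (gH (n + 1)), mul_comm (gH 0), hMH, hMH]
  -- the nonpositive half-line
  have hnonpos : ∀ u : ℝ, u ≤ 0 → herbrandPhi 𝔓 G u = herbrandPhi 𝔮 Q (herbrandPhi 𝔓 π.ker u) := by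
    intro u hu
    rw [herbrandPhi_of_nonpos 𝔓 hu, herbrandPhi_of_nonpos 𝔓 hu, herbrandPhi_of_nonpos 𝔮 hu]
  -- one step: from the anchor at `n` to the interval `[n, n+1]`
  have hstep : ∀ n : ℕ, herbrandPhi 𝔓 G n = herbrandPhi 𝔮 Q (herbrandPhi 𝔓 π.ker n) →
      ∀ u ∈ Icc (n : ℝ) (n + 1), herbrandPhi 𝔓 G u = herbrandPhi 𝔮 Q (herbrandPhi 𝔓 π.ker u) := by
    intro n hanchor u hu
    set α := herbrandPhi 𝔓 π.ker n with hα
    set t := herbrandPhi 𝔓 π.ker u with ht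
    have hαt : α ≤ t := herbrandPhi_mono 𝔓 _ hu.1
    -- the integrand of `φ_Q` is constant on `(α, t]`
    have hconst : EqOn (herbrandIntegrand 𝔮 Q) (fun _ => gM (n + 1) / gQ 0) (Ioc α t) := by
      intro t' ht'
      set w := herbrandPsi 𝔓 π.ker t' with hw
      have hφw : herbrandPhi 𝔓 π.ker w = t' := herbrandPhi_herbrandPsi_holds 𝔓 _ t'
      have hnw : (n : ℝ) < w := by
        rw [← (herbrandPhi_strictMono 𝔓 π.ker).lt_iff_lt, hφw]
        exact ht'.1
      have hwu : w ≤ u := by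
        rw [← (herbrandPhi_strictMono 𝔓 π.ker).le_iff_le, hφw]
        exact ht'.2
      have hceil : ⌈w⌉₊ = n + 1 := by
        rw [Nat.ceil_eq_iff (Nat.succ_ne_zero n), Nat.succ_sub_one]
        push_cast
        exact ⟨hnw, hwu.trans hu.2⟩
      have hmap := map_ramificationSubgroup_eq_of_indexFormula 𝔓 𝔮 π hI hN h3 w
      rw [hφw, hceil] at hmap
      change herbrandIntegrand 𝔮 Q t' = gM (n + 1) / gQ 0
      rw [herbrandIntegrand, inv_div, ← hmap]
    have hQaff : herbrandPhi 𝔮 Q t - herbrandPhi 𝔮 Q α = (t - α) * (gM (n + 1) / gQ 0) :=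
      herbrandPhi_sub_eq_mul_of_eqOn 𝔮 Q hαt hconst
    have hHaff : t - α = (u - n) * (gH (n + 1) / gH 0) :=
      herbrandPhi_sub_eq_of_Icc 𝔓 π.ker n le_rfl hu.1 hu.2
    have hGaff : herbrandPhi 𝔓 G u = herbrandPhi 𝔓 G n + (u - n) * (gG (n + 1) / gG 0) :=
      herbrandPhi_eq_of_mem_Icc 𝔓 G n hu
    rw [hGaff, hanchor, ← hslope n]
    change herbrandPhi 𝔮 Q α + _ = herbrandPhi 𝔮 Q t
    rw [hHaff] at hQaff
    linarith
  -- anchors by induction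
  have hanchor : ∀ n : ℕ, herbrandPhi 𝔓 G n = herbrandPhi 𝔮 Q (herbrandPhi 𝔓 π.ker n) := by
    intro n
    induction n with
    | zero => exact_mod_cast hnonpos 0 le_rfl
    | succ n ih =>
      have := hstep n ih (n + 1) ⟨by linarith, le_rfl⟩
      exact_mod_cast this
  -- conclusion
  rcases le_or_gt u 0 with hu | hu
  · exact hnonpos u hu
  · exact hstep ⌊u⌋₊ (hanchor _) u ⟨Nat.floor_le hu.le, (Nat.lt_floor_add_one u).le⟩

/-- **Serre's Prop. 14**, abstract form: under the hypotheses of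
`map_ramificationSubgroup_eq_of_indexFormula`, the upper numbering passes to the quotient:
`Q^v = π(G^v)` for all `v : ℝ`, i.e. `(G/H)^v = G^v H/H`.
Proof (Serre's): `(G/H)^v = (G/H)_{ψ_Q v} = π(G_u)` with `φ_H(u) = ψ_Q(v)` (Lemma 5), and
`u = ψ_G(v)` by transitivity (Prop. 15).
Ref: Serre, *Local Fields*, Ch. IV §3, Prop. 14, p. 74–76. [cite: SerreLocalFields1979, Ch. IV §3 Prop. 14 (pp. 74–76)] -/
theorem upperRamificationSubgroup_eq_map_of_indexFormula
    (hI : (𝔓.ramificationSubgroup G 0).map π = 𝔮.ramificationSubgroup Q 0) {N : ℕ}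
    (hN : 𝔓.ramificationSubgroup G N = ⊥) (h3 : IndexFormula 𝔓 𝔮 π) (v : ℝ) :
    upperRamificationSubgroup 𝔮 Q v = (upperRamificationSubgroup 𝔓 G v).map π := by
  set u := herbrandPsi 𝔓 π.ker (herbrandPsi 𝔮 Q v) with hu
  have hφu : herbrandPhi 𝔓 π.ker u = herbrandPsi 𝔮 Q v := herbrandPhi_herbrandPsi_holds 𝔓 _ _
  have hG : herbrandPsi 𝔓 G v = u := by
    apply herbrandPhi_injective 𝔓 G
    rw [herbrandPhi_herbrandPsi_holds 𝔓 G v, herbrandPhi_eq_herbrandPhi_comp_of_indexFormula 𝔓 𝔮 π hI hN h3 u,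
      hφu, herbrandPhi_herbrandPsi_holds 𝔮 Q v]
  rw [upperRamificationSubgroup, upperRamificationSubgroup, hG, ← hφu]
  exact (map_ramificationSubgroup_eq_of_indexFormula 𝔓 𝔮 π hI hN h3 u).symm

end Quotient

/-! ### Surjectivity of inertia along `Gal(L/K) → Gal(E/K)` (Serre, Ch. I §7, Prop. 22 b)) -/
section InertiaLiftFinite

variable {B : Type*} [CommRing B] {Γ : Type*} [Group Γ] [MulSemiringAction Γ B]

/-- **Lifting inertia through a finite subgroup.**  Let the group `Γ` act on the commutative ring
`B`, let `N ≤ Γ` be a finite subgroup and `𝔓 ⊂ B` a prime ideal.  If `g ∈ Γ` satisfies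
`g • b - b ∈ 𝔓` for every `N`-invariant `b ∈ B`, then `n * g * n' ∈ I_𝔓(Γ)` for some `n, n' ∈ N`.
(The finite-group counterpart of `Literature.NumberTheory.GaloisRepresentations.exists_mul_mul_mem_inertia`; proof: `g⁻¹𝔓` and `𝔓` contract
to the same prime of `B^N`, so `g n₁` stabilises `𝔓` for some `n₁ ∈ N` by transitivity
(`Algebra.IsInvariant.exists_smul_of_under_eq`); the induced `B^N/(𝔓 ∩ B^N)`-automorphism of `B/𝔓`
comes from some `n₂ ∈ N` (`Ideal.Quotient.stabilizerHom_surjective`), and `n₂⁻¹ g n₁ ∈ I_𝔓`.)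
Ref: Serre, *Local Fields*, Ch. I §7, Prop. 22 b) and its proof (surjectivity of `D(L/K) → D(E/K)`,
then diagram chase). [cite: SerreLocalFields1979, Ch. I §7 Prop. 22 b)] -/
theorem exists_mul_mul_mem_inertia_of_finite (N : Subgroup Γ) [Finite N]
    (𝔓 : Ideal B) [𝔓.IsPrime] (g : Γ)
    (hg : ∀ b : B, (∀ n ∈ N, n • b = b) → g • b - b ∈ 𝔓) :
    ∃ n ∈ N, ∃ n' ∈ N, n * g * n' ∈ 𝔓.inertia Γ := by
  classical
  -- the ring of `N`-invariants
  let A : Subring B := FixedPoints.subring B N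
  haveI : Algebra.IsInvariant A B N := ⟨fun b hb ↦ ⟨⟨b, hb⟩, rfl⟩⟩
  have hfix : ∀ a : A, ∀ n ∈ N, n • (a : B) = a := fun a n hn ↦ a.2 ⟨n, hn⟩
  -- Step 1: `g⁻¹ • 𝔓` and `𝔓` lie over the same prime of `A`, so `g * n₁ ∈ D_𝔓` for some `n₁ ∈ N`.
  have hunder : 𝔓.under A = (g⁻¹ • 𝔓).under A := by
    ext a
    simp only [Ideal.under, Ideal.mem_comap]
    rw [Ideal.mem_inv_pointwise_smul_iff]
    change (a : B) ∈ 𝔓 ↔ g • (a : B) ∈ 𝔓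
    have hga : g • (a : B) - a ∈ 𝔓 := hg a (hfix a)
    constructor
    · intro h
      simpa using 𝔓.add_mem hga h
    · intro h
      simpa using 𝔓.sub_mem h hga
  obtain ⟨n₁, hn₁⟩ :=
    Algebra.IsInvariant.exists_smul_of_under_eq A B N 𝔓 (g⁻¹ • 𝔓) hunder
  have hn₁' : (g⁻¹ • 𝔓 : Ideal B) = ((n₁ : Γ) • 𝔓 : Ideal B) := hn₁
  set g₁ : Γ := g * (n₁ : Γ) with hg₁def
  have hg₁ : g₁ • 𝔓 = 𝔓 := by
    rw [hg₁def, mul_smul, ← hn₁', smul_inv_smul]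
  have hg₁fix : ∀ a : A, g₁ • (a : B) - a ∈ 𝔓 := by
    intro a
    rw [hg₁def, mul_smul, hfix a _ n₁.2]
    exact hg a (hfix a)
  -- Step 2: the automorphism of `B ⧸ 𝔓` induced by `g₁` is `A ⧸ (𝔓 ∩ A)`-linear.
  let e : B ≃+* B := MulSemiringAction.toRingEquiv Γ B g₁
  have he : 𝔓 = 𝔓.map (e : B →+* B) := by
    rw [Ideal.map_comap_of_equiv]
    ext x
    rw [Ideal.mem_comap]
    change x ∈ 𝔓 ↔ g₁⁻¹ • x ∈ 𝔓
    rw [← Ideal.mem_pointwise_smul_iff_inv_smul_mem, hg₁]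
  let θ₀ : B ⧸ 𝔓 ≃+* B ⧸ 𝔓 := Ideal.quotientEquiv 𝔓 𝔓 e he
  have hθ₀ : ∀ b : B, θ₀ (Ideal.Quotient.mk 𝔓 b) = Ideal.Quotient.mk 𝔓 (g₁ • b) := fun b ↦
    Ideal.quotientEquiv_mk 𝔓 𝔓 e he b
  let θ : (B ⧸ 𝔓) ≃ₐ[A ⧸ 𝔓.under A] (B ⧸ 𝔓) :=
    { θ₀ with
      commutes' := by
        intro r
        obtain ⟨a, rfl⟩ := Ideal.Quotient.mk_surjective r
        rw [Ideal.Quotient.algebraMap_mk_of_liesOver]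
        change θ₀ (Ideal.Quotient.mk 𝔓 (a : B)) = Ideal.Quotient.mk 𝔓 (a : B)
        rw [hθ₀, Ideal.Quotient.eq]
        exact hg₁fix a }
  have hθ : ∀ b : B, θ (Ideal.Quotient.mk 𝔓 b) = Ideal.Quotient.mk 𝔓 (g₁ • b) := hθ₀
  -- Step 3: by surjectivity of `D_𝔓(N) → Aut((B ⧸ 𝔓)/(A ⧸ 𝔓 ∩ A))`, `θ` is induced by some `n₂ ∈ N`.
  obtain ⟨n₂, hn₂⟩ := Ideal.Quotient.stabilizerHom_surjective N (𝔓.under A) 𝔓 θ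
  have hn₂b : ∀ b : B, g₁ • b - ((n₂ : N) : Γ) • b ∈ 𝔓 := by
    intro b
    rw [← Ideal.Quotient.eq, ← hθ b]
    have := DFunLike.congr_fun hn₂ (Ideal.Quotient.mk 𝔓 b)
    rw [Ideal.Quotient.stabilizerHom_apply] at this
    exact this.symm
  have hn₂stab : ((n₂ : N) : Γ) • 𝔓 = 𝔓 := n₂.2
  -- Step 4: `n₂⁻¹ * g * n₁` lies in the inertia group of `𝔓`.
  refine ⟨((n₂ : N) : Γ)⁻¹, N.inv_mem (n₂ : N).2, (n₁ : Γ), n₁.2, ?_⟩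
  rw [Ideal.inertia, AddSubgroup.mem_inertia]
  intro b
  have hinv : ((n₂ : N) : Γ)⁻¹ • 𝔓 = 𝔓 := by
    rw [inv_smul_eq_iff, hn₂stab]
  have h1 : ((n₂ : N) : Γ)⁻¹ • (g₁ • b - ((n₂ : N) : Γ) • b) ∈ ((n₂ : N) : Γ)⁻¹ • 𝔓 :=
    Ideal.smul_mem_pointwise_smul _ _ _ (hn₂b b)
  rw [hinv, smul_sub, inv_smul_smul] at h1
  simpa [hg₁def, mul_smul, mul_assoc] using h1

end InertiaLiftFinite

section RestrictNormalInertia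

variable (R : Type*) {K L : Type*} [CommRing R] [Field K] [Field L] [Algebra R K] [Algebra R L]
  [Algebra K L] [IsScalarTower R K L] (E : IntermediateField K L)

/-- The kernel of `Gal(L/K) → Gal(E/K)` is the fixing subgroup of `E`. [folklore] -/
theorem ker_restrictNormalHom_eq_fixingSubgroup [Normal K E] :
    (AlgEquiv.restrictNormalHom E : (L ≃ₐ[K] L) →* (E ≃ₐ[K] E)).ker = E.fixingSubgroup := by
  ext σ
  rw [MonoidHom.mem_ker, IntermediateField.mem_fixingSubgroup_iff, AlgEquiv.ext_iff]
  refine ⟨fun h x hx => ?_, fun h x => ?_⟩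
  · have := congrArg (fun y : E => (y : L)) (h ⟨x, hx⟩)
    simpa [AlgEquiv.restrictNormalHom_apply] using this
  · apply Subtype.ext
    rw [AlgEquiv.restrictNormalHom_apply]
    exact h x x.2

/-- **Inertia surjects along `Gal(L/K) → Gal(E/K)`.**  For `L/K` finite Galois, `E/K` a normal
subextension, `S_L = integralClosure R L` and a prime `𝔓` of `S_L` with `𝔓_E = 𝔓 ∩ E`, the
restriction maps the inertia group `T_𝔓(L/K)` onto `T_{𝔓_E}(E/K)`.
Ref: Serre, *Local Fields*, Ch. I §7, Prop. 22 b) (exactness of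
`1 → T(L/E) → T(L/K) → T(E/K) → 1`). [cite: SerreLocalFields1979, Ch. I §7 Prop. 22 b)] -/
theorem map_inertia_restrictNormalHom [FiniteDimensional K L] [IsGalois K L] [Normal K E]
    (𝔓 : Ideal (integralClosure R L)) [𝔓.IsPrime] :
    (𝔓.inertia (L ≃ₐ[K] L)).map (AlgEquiv.restrictNormalHom E) =
      (𝔓.comap (E.integralClosureInclusion R)).inertia (E ≃ₐ[K] E) := by
  apply le_antisymm
  · rintro _ ⟨σ, hσ, rfl⟩
    refine AddSubgroup.mem_inertia.mpr fun y => ?_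
    change E.integralClosureInclusion R (AlgEquiv.restrictNormalHom E σ • y - y) ∈ 𝔓
    rw [map_sub, E.integralClosureInclusion_restrictNormalHom_smul R σ y]
    exact AddSubgroup.mem_inertia.mp hσ _
  · intro τ hτ
    obtain ⟨g, rfl⟩ := AlgEquiv.restrictNormalHom_surjective L τ
    have hg : ∀ b : integralClosure R L,
        (∀ n ∈ (AlgEquiv.restrictNormalHom E : (L ≃ₐ[K] L) →* (E ≃ₐ[K] E)).ker, n • b = b) →
          g • b - b ∈ 𝔓 := by
      intro b hb
      -- `b ∈ E` by the Galois correspondence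
      have hbE : (b : L) ∈ E := by
        rw [← IsGalois.fixedField_fixingSubgroup E, IntermediateField.mem_fixedField_iff]
        intro f hf
        rw [← ker_restrictNormalHom_eq_fixingSubgroup] at hf
        have := congrArg (fun z : integralClosure R L => (z : L)) (hb f hf)
        simpa using this
      have hbint : IsIntegral R (⟨b, hbE⟩ : E) :=
        (isIntegral_algHom_iff ((E.val).restrictScalars R) (fun _ _ h => Subtype.ext h)).mp b.2
      set y : integralClosure R E := ⟨⟨b, hbE⟩, hbint⟩ with hy
      have hιy : E.integralClosureInclusion R y = b := Subtype.ext rfl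
      have h := AddSubgroup.mem_inertia.mp hτ y
      change E.integralClosureInclusion R (AlgEquiv.restrictNormalHom E g • y - y) ∈ 𝔓 at h
      rw [map_sub, E.integralClosureInclusion_restrictNormalHom_smul R g y, hιy] at h
      exact h
    obtain ⟨n, hn, n', hn', h⟩ := exists_mul_mul_mem_inertia_of_finite _ 𝔓 g hg
    refine ⟨n * g * n', h, ?_⟩
    rw [map_mul, map_mul, (MonoidHom.mem_ker).mp hn, (MonoidHom.mem_ker).mp hn', one_mul, mul_one]

end RestrictNormalInertia

/-! ### Specialisation: `Gal(L/K) → Gal(E/K)` on integral closures (the setting of `herbrand_quotient`) -/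

section RestrictNormal

variable (R : Type*) {K L : Type*} [CommRing R] [Field K] [Field L] [Algebra R K] [Algebra R L]
  [Algebra K L] [IsScalarTower R K L] (E : IntermediateField K L)

/-- **Herbrand's theorem for `Gal(L/K) → Gal(E/K)` from the index formula.**  `R` Dedekind with
fraction field `K`, `L/K` finite Galois, `E/K` a normal subextension, `𝔓` a maximal ideal of
`S_L = integralClosure R L`, `𝔓_E = 𝔓 ∩ E`.  If Serre's index formula (Ch. IV §1 Prop. 3, as the
hypothesis `IndexFormula` with `e' = Card(H_0)`, `H = Gal(L/E)`) holds at `𝔓`, then for every `v`,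
`Gal(E/K)^v = Gal(L/K)^v H/H` (the statement of the named fact `Literature.NumberTheory.GaloisRepresentations.herbrand_quotient` at `𝔓`):
by Serre's Lemmas 3–5 and Prop. 15 (`upperRamificationSubgroup_eq_map_of_indexFormula`), the
surjectivity of inertia (`map_inertia_restrictNormalHom`, Ch. I §7 Prop. 22 b)), and the eventual
triviality of the lower filtration (`Ideal.ramificationSubgroup_eventually_eq_bot_holds`).
Ref: Serre, *Local Fields*, Ch. IV §3, Prop. 14, p. 74–76, with Ch. IV §1 Remark 2 (global case). [cite: SerreLocalFields1979, Ch. IV §3 Prop. 14 (pp. 74–76) and §1 Remark 2] -/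
theorem upperRamificationSubgroup_eq_map_restrictNormalHom_of_indexFormula [IsDedekindDomain R]
    [IsFractionRing R K] [FiniteDimensional K L] [IsGalois K L] [Normal K E]
    (𝔓 : Ideal (integralClosure R L)) [𝔓.IsMaximal]
    (h3 : IndexFormula 𝔓 (𝔓.comap (E.integralClosureInclusion R))
      (AlgEquiv.restrictNormalHom E : (L ≃ₐ[K] L) →* (E ≃ₐ[K] E))) (v : ℝ) :
    upperRamificationSubgroup (𝔓.comap (E.integralClosureInclusion R)) (E ≃ₐ[K] E) v =
      (upperRamificationSubgroup 𝔓 (L ≃ₐ[K] L) v).map (AlgEquiv.restrictNormalHom E) := by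
  haveI : IsFractionRing (integralClosure R L) L :=
    integralClosure.isFractionRing_of_finite_extension K L
  haveI : FaithfulSMul (L ≃ₐ[K] L) (integralClosure R L) :=
    (IsGaloisGroup.of_isFractionRing (L ≃ₐ[K] L) R (integralClosure R L) K L).faithful
  haveI : IsNoetherianRing (integralClosure R L) := integralClosure.isNoetherianRing (K := K) L
  obtain ⟨N, hN⟩ := Ideal.ramificationSubgroup_eventually_eq_bot_holds 𝔓 (L ≃ₐ[K] L)
    (Ideal.IsMaximal.ne_top inferInstance)
  have hI : (𝔓.ramificationSubgroup (L ≃ₐ[K] L) 0).map (AlgEquiv.restrictNormalHom E) =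
      (𝔓.comap (E.integralClosureInclusion R)).ramificationSubgroup (E ≃ₐ[K] E) 0 := by
    rw [Ideal.ramificationSubgroup_zero, Ideal.ramificationSubgroup_zero]
    exact map_inertia_restrictNormalHom R E 𝔓
  exact upperRamificationSubgroup_eq_map_of_indexFormula 𝔓 _ (AlgEquiv.restrictNormalHom E) hI
    (hN N le_rfl) h3 v

end RestrictNormal

end Literature.NumberTheory.GaloisRepresentations
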